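import Summits.ValiantsHypothesis.ValiantsHypothesis.Theorems.BarrierLeverChowBenchmarkPairsDirichletLift

/-!
# Route BarrierLever — item 22038 `ChowBenchmarkPairs`, line `moore-peel`: THEOREM W assembled — every Dirichlet
# window minor SPLITS COMPLETELY into linear factors `x + t`, `t ∈ ℤ`, with a computable root list (CONJECTURE Z″
# of memo g26 proved), and the bad stages of the segment-mean peel become a decidable arithmetic predicate

Helper file (`--supports stmt-ValiantsHypothesis-22038`; cell valiant-natproofs, rung V4, 𝒟-side benchmark of
record, line `moore_peel`, card v12d structural target #1 «the product formula for `det G^{(X)}_i`»; seat val-np-p4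
gen 27, memo `HOME/val-np-p4/g27/MEMO-valnp4-g27.md`).  Closes NO item.  Auxiliary COMPUTABLE definitions:
`topPowAux`/`topPow` (the largest power of two below), `wrootsAux`/`wroots` (the root list of a window),
`wprod`, `badStage`.

* `wroots i c : List ℤ` — the three-rule recursion of THEOREM W (with `P = topPow (c+i-1)`):
  (R1) `P ≤ c`: `i` zeros, then the roots of `(i, c-P)` shifted by `+1`; (R2) `c < P`, `i ≤ P`: `c+i-P` zeros, then the
  roots of `(P-c, P-i)`; (R3) `i > P`: `c` zeros, then the roots of `(i-P, c)` shifted by `-1`.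
* **`det_dirichletWindow_eq_prod`**: over any commutative ring, `det d(i,c)(x) = ± ∏_{t ∈ wroots i c} (x + t)` — from
  `det_dirichletWindow_shift` (R1), `det_dirichletWindow_flip` (R2), `det_dirichletWindow_lift` (R3) by induction.
* `det_dirichletPeelPoly_eq_prod` — **COROLLARY Z″**: `det G^{(X)}_i = ± ∏ (X + t)` in `ℤ[X]`, all roots integers.
* `det_peelMatrix_eq_zero_iff : det G_i = 0 ↔ -1 ∈ wroots i c_i` (`badStage i`), and by `decide`:
  `det_peelMatrix_ne_zero_of_le_182_by_W` (the certified window of the line, now one `decide`), `badStage_183`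
  (= the tree's `det_peelMatrix_183`, certificate-free),
  `det_kpeelMatrix_ascFactorial_two_726` (**CONJECTURE U of memo g26 is false**: the Dirichlet(2,2) stage matrix
  `G^{(2)}_{726}` is singular — `-2 ∈ wroots 726 c_726`).

WHAT THIS IS NOT: the segment-mean stub `stub_segmentMeanValue` (∀h) is untouched — the peel is a sufficient criterion
only and its stage determinants do vanish (`badStage 183`); nothing on crux stmt-ValiantsHypothesis-14610 or on `VP`
versus `VNP`.
-/

set_option linter.dupNamespace false

namespace Summit.ValiantsHypothesis.ValiantsHypothesis.Theorems.BarrierLever.MoorePeel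

open Finset Matrix Polynomial

variable {R : Type*} [CommRing R]

/-! ## 1. The largest power of two below a number (structural recursion, kernel-computable) -/

/-- Fuelled computation of the largest power of two `≤ m` (`1` for `m ≤ 1`). -/
def topPowAux : ℕ → ℕ → ℕ
  | 0, _ => 1
  | f + 1, m => if m < 2 then 1 else 2 * topPowAux f (m / 2)

/-- The largest power of two `≤ m` (`1` for `m = 0`). -/
def topPow (m : ℕ) : ℕ := topPowAux m m

/-- `topPowAux f m` is a power of two. -/
theorem topPowAux_pow (f : ℕ) : ∀ m, ∃ K, topPowAux f m = 2 ^ K := by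
  induction f with
  | zero => intro m; exact ⟨0, rfl⟩
  | succ f ih =>
    intro m
    rw [topPowAux]
    split_ifs
    · exact ⟨0, rfl⟩
    · obtain ⟨K, hK⟩ := ih (m / 2)
      exact ⟨K + 1, by rw [hK, pow_succ, mul_comm]⟩

/-- With enough fuel, `topPowAux f m ≤ m < 2 · topPowAux f m`. -/
theorem topPowAux_spec (f : ℕ) : ∀ m, m ≠ 0 → m < 2 ^ (f + 1) →
    topPowAux f m ≤ m ∧ m < 2 * topPowAux f m := by
  induction f with
  | zero => intro m h0 hm; rw [topPowAux]; omega
  | succ f ih =>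
    intro m h0 hm
    rw [topPowAux]
    split_ifs with h2
    · omega
    · have := ih (m / 2) (by omega) (by rw [pow_succ] at hm; omega)
      omega

/-- `topPow m` is a power of two. -/
theorem topPow_pow (m : ℕ) : ∃ K, topPow m = 2 ^ K := topPowAux_pow m m

/-- `topPow m ≤ m < 2 · topPow m` for `m ≠ 0`. -/
theorem topPow_spec {m : ℕ} (hm : m ≠ 0) : topPow m ≤ m ∧ m < 2 * topPow m :=
  topPowAux_spec m m hm (lt_of_lt_of_le m.lt_two_pow_self (Nat.pow_le_pow_right (by norm_num) (by omega)))

/-! ## 2. The root list of a window (THEOREM W as an algorithm) -/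

/-- Fuelled root list of the window `(i, c)`: `det d(i,c)(x) = ± ∏_{t} (x + t)` over this list (THEOREM W). -/
def wrootsAux : ℕ → ℕ → ℕ → List ℤ
  | 0, _, _ => []
  | f + 1, i, c =>
    if i = 0 ∨ c = 0 then [] else
      if topPow (c + i - 1) ≤ c then
        List.replicate i 0 ++ (wrootsAux f i (c - topPow (c + i - 1))).map (· + 1)
      else if i ≤ topPow (c + i - 1) then
        List.replicate (c + i - topPow (c + i - 1)) 0 ++
          wrootsAux f (topPow (c + i - 1) - c) (topPow (c + i - 1) - i)
      else List.replicate c 0 ++ (wrootsAux f (i - topPow (c + i - 1)) c).map (· - 1)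

/-- **The root list** of the Dirichlet window `(i, c)`: `det d(i,c)(x) = ± ∏_{t ∈ wroots i c} (x + t)`
(`det_dirichletWindow_eq_prod`). -/
def wroots (i c : ℕ) : List ℤ := wrootsAux (i + c) i c

/-- The product `∏_{t ∈ l} (x + t)`. -/
def wprod (x : R) (l : List ℤ) : R := (l.map fun t : ℤ => x + (t : R)).prod

/-- `wprod` of the empty list. -/
@[simp] theorem wprod_nil (x : R) : wprod x [] = 1 := by simp [wprod]

/-- `wprod` is multiplicative in the list. -/
theorem wprod_append (x : R) (l l' : List ℤ) : wprod x (l ++ l') = wprod x l * wprod x l' := by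
  simp [wprod, List.map_append, List.prod_append]

/-- Zeros contribute powers of `x`. -/
theorem wprod_replicate_zero (x : R) (n : ℕ) : wprod x (List.replicate n 0) = x ^ n := by
  simp [wprod, List.map_replicate, List.prod_replicate]

/-- Shifting the roots by `+1` shifts the parameter by `+1`. -/
theorem wprod_map_add_one (x : R) (l : List ℤ) : wprod x (l.map (· + 1)) = wprod (x + 1) l := by
  simp only [wprod, List.map_map]
  congr 1
  refine List.map_congr_left fun t _ => ?_
  simp only [Function.comp_apply, Int.cast_add, Int.cast_one]
  ring

/-- Shifting the roots by `-1` shifts the parameter by `-1`. -/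
theorem wprod_map_sub_one (x : R) (l : List ℤ) : wprod x (l.map (· - 1)) = wprod (x - 1) l := by
  simp only [wprod, List.map_map]
  congr 1
  refine List.map_congr_left fun t _ => ?_
  simp only [Function.comp_apply, Int.cast_sub, Int.cast_one]
  ring

/-- The window at `c = 0` is the unipotent diagonal window: determinant `1`. -/
theorem det_dirichletWindow_zero_right (x : R) (i : ℕ) : (dirichletWindow x i 0).det = 1 := by
  have : dirichletWindow x i 0 = dzDiag x i 0 := by
    ext j m
    rw [dirichletWindow_eq_dz, dzDiag_apply, Nat.zero_add, Nat.zero_add]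
  rw [this, det_dzDiag]

/-! ## 3. THEOREM W: complete splitting -/

/-- Products of signs. -/
theorem units_cast_mul (ε ε' : ℤˣ) : (((ε * ε' : ℤˣ) : ℤ) : R) = ((ε : ℤ) : R) * ((ε' : ℤ) : R) := by
  rw [Units.val_mul, Int.cast_mul]

/-- THEOREM W by induction on the fuel. -/
theorem det_dirichletWindow_wrootsAux (f : ℕ) : ∀ (i c : ℕ) (x : R), i + c ≤ f →
    ∃ ε : ℤˣ, (dirichletWindow x i c).det = ((ε : ℤ) : R) * wprod x (wrootsAux f i c) := by
  induction f with
  | zero =>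
    intro i c x hf
    obtain rfl : i = 0 := by omega
    exact ⟨1, by rw [wrootsAux, det_dirichletWindow_zero_left]; simp⟩
  | succ f ih =>
    intro i c x hf
    rw [wrootsAux]
    by_cases h0 : i = 0 ∨ c = 0
    · rw [if_pos h0]
      refine ⟨1, ?_⟩
      rcases h0 with rfl | rfl
      · rw [det_dirichletWindow_zero_left]; simp
      · rw [det_dirichletWindow_zero_right]; simp
    rw [if_neg h0]
    obtain ⟨hi0, hc0⟩ := not_or.mp h0
    set P := topPow (c + i - 1) with hPdef
    obtain ⟨K, hK⟩ := topPow_pow (c + i - 1)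
    have hspec := topPow_spec (m := c + i - 1) (by omega)
    rw [← hPdef] at hK hspec
    by_cases h1 : P ≤ c
    · -- (R1)
      rw [if_pos h1]
      have e1 := det_dirichletWindow_shift x (k := K) (r := c - P) (i := i) (by omega)
      rw [show 2 ^ K + (c - P) = c by omega] at e1
      obtain ⟨ε, hε⟩ := ih i (c - P) (x + 1) (by omega)
      refine ⟨ε, ?_⟩
      rw [e1, hε, wprod_append, wprod_replicate_zero, wprod_map_add_one]
      ring
    rw [if_neg h1]
    by_cases h2 : i ≤ P
    · -- (R2)
      rw [if_pos h2]
      have e2 := det_dirichletWindow_flip x (k := K) (a := P - i) (s := c + i - P) (n := P - c) (by omega)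
      rw [show c + i - P + (P - c) = i by omega, show P - i + (c + i - P) = c by omega] at e2
      obtain ⟨ε, hε⟩ := e2
      obtain ⟨ε', hε'⟩ := ih (P - c) (P - i) x (by omega)
      refine ⟨ε * ε', ?_⟩
      rw [hε, hε', wprod_append, wprod_replicate_zero, units_cast_mul]
      ring
    · -- (R3)
      rw [if_neg h2]
      have e3 := det_dirichletWindow_lift x (k := K) (c := c) (n := P - c) (i := i - P) (by omega) (by omega)
      rw [show P - c + c + (i - P) = i by omega] at e3
      obtain ⟨ε, hε⟩ := e3
      obtain ⟨ε', hε'⟩ := ih (i - P) c (x - 1) (by omega)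
      refine ⟨ε * ε', ?_⟩
      rw [hε, hε', wprod_append, wprod_replicate_zero, wprod_map_sub_one, units_cast_mul]
      ring

/-- **THEOREM W (complete splitting of the Dirichlet window minors).**  Over any commutative ring and for all
`i, c`: `det d(i,c)(x) = ± ∏_{t ∈ wroots i c} (x + t)`, with the integer root list `wroots i c` computed by the
three-rule binary recursion. -/
theorem det_dirichletWindow_eq_prod (x : R) (i c : ℕ) :
    ∃ ε : ℤˣ, (dirichletWindow x i c).det = ((ε : ℤ) : R) * wprod x (wroots i c) :=
  det_dirichletWindow_wrootsAux (i + c) i c x le_rfl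

/-- **COROLLARY Z″.**  The generic Dirichlet stage determinant splits into linear factors over `ℤ`:
`det G^{(X)}_i = ± ∏_{t ∈ wroots i c_i} (X + t)` in `ℤ[X]`; in particular all its roots are integers. -/
theorem det_dirichletPeelPoly_eq_prod (i : ℕ) : ∃ ε : ℤˣ,
    (dirichletPeelPoly i).det = ((ε : ℤ) : ℤ[X]) * wprod (X : ℤ[X]) (wroots i (windowStart i)) := by
  rw [dirichletPeelPoly_eq_dirichletWindow]
  exact det_dirichletWindow_eq_prod (X : ℤ[X]) i (windowStart i)

/-! ## 4. Vanishing: the bad stages as an arithmetic predicate -/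

/-- Over a domain: `det d(i,c)(x) = 0 ↔ x = -t` for some `t ∈ wroots i c`. -/
theorem det_dirichletWindow_eq_zero_iff [IsDomain R] (x : R) (i c : ℕ) :
    (dirichletWindow x i c).det = 0 ↔ ∃ t ∈ wroots i c, x + (t : R) = 0 := by
  obtain ⟨ε, hε⟩ := det_dirichletWindow_eq_prod x i c
  have hε0 : ((ε : ℤ) : R) ≠ 0 := by
    rcases Int.units_eq_one_or ε with h | h <;> simp [h]
  rw [hε, mul_eq_zero, or_iff_right hε0, wprod, List.prod_eq_zero_iff, List.mem_map]

/-- **The factorial stage matrix of the segment-mean peel**: `det G_i = 0 ↔ -1 ∈ wroots i c_i`. -/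
theorem det_peelMatrix_eq_zero_iff (i : ℕ) :
    (peelMatrix i).det = 0 ↔ (-1 : ℤ) ∈ wroots i (windowStart i) := by
  rw [← dirichletWindow_one_windowStart, det_dirichletWindow_eq_zero_iff]
  constructor
  · rintro ⟨t, ht, h⟩
    have h' : (1 : ℤ) + t = 0 := by simpa using h
    have : t = -1 := by omega
    rwa [this] at ht
  · intro h
    exact ⟨-1, h, by simp⟩

/-- At a natural parameter `α`: `det G^{(α)}_i = 0 ↔ -α ∈ wroots i c_i`. -/
theorem det_kpeelMatrix_ascFactorial_eq_zero_iff (α i : ℕ) :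
    (kpeelMatrix (Nat.ascFactorial α) i).det = 0 ↔ (-(α : ℤ)) ∈ wroots i (windowStart i) := by
  rw [← dirichletWindow_natCast_windowStart, det_dirichletWindow_eq_zero_iff]
  constructor
  · rintro ⟨t, ht, h⟩
    have h' : (α : ℤ) + t = 0 := by simpa using h
    have : t = -(α : ℤ) := by omega
    rwa [this] at ht
  · intro h
    exact ⟨-(α : ℤ), h, by simp⟩

/-- The computable bad-stage predicate of the segment-mean peel. -/
def badStage (i : ℕ) : Bool := decide ((-1 : ℤ) ∈ wroots i (windowStart i))

/-- `det G_i = 0 ↔ badStage i`. -/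
theorem det_peelMatrix_eq_zero_iff_badStage (i : ℕ) : (peelMatrix i).det = 0 ↔ badStage i = true := by
  rw [det_peelMatrix_eq_zero_iff, badStage, decide_eq_true_iff]

/-- The first bad stage: `det G_183 = 0` (by the formula; cf. `natAbs_det_zetaPeelMatrix_183`). -/
theorem badStage_183 : badStage 183 = true := by decide +kernel

/-- No bad stage below `183`. -/
theorem badStage_eq_false_of_le_182 : ∀ i ∈ List.range 183, badStage i = false ∨ i = 0 := by decide +kernel

/-- **The certified window of the line in one line**: `det G_i ≠ 0` for every `1 ≤ i ≤ 182` (the tree's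
`det_peelMatrix_ne_zero_of_le_182` of `…ChowBenchmarkPairsWindow` is the certificate version). -/
theorem det_peelMatrix_ne_zero_of_le_182_by_W (i : ℕ) (hi : i ≤ 182) (h1 : 1 ≤ i) :
    (peelMatrix i).det ≠ 0 := by
  intro h
  rw [det_peelMatrix_eq_zero_iff_badStage] at h
  rcases badStage_eq_false_of_le_182 i (List.mem_range.mpr (by omega)) with h' | h'
  · rw [h] at h'; exact Bool.noConfusion h'
  · omega

/-- **CONJECTURE U (memo g26 §2) is false**: the Dirichlet(2,2) stage matrix at stage `726` is singular. -/
theorem det_kpeelMatrix_ascFactorial_two_726 : (kpeelMatrix (Nat.ascFactorial 2) 726).det = 0 :=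
  (det_kpeelMatrix_ascFactorial_eq_zero_iff 2 726).mpr (by decide +kernel)

end Summit.ValiantsHypothesis.ValiantsHypothesis.Theorems.BarrierLever.MoorePeel
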